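import Mathlib
import HarnessLib
import Summits.Ventures.LatticeQCDFlow.Exactness.SU2WilsonFlowLOTranslation
import Summits.Ventures.LatticeQCDFlow.Exactness.SU2FTHMCTranslationCovariance
import Summits.Ventures.LatticeQCDFlow.Exactness.SU2FTHMCGaugeCovarianceMembers

/-!
# The row's acceptance configuration under LATTICE TRANSLATIONS: on the 4⁴ `SU(2)` lattice with parity masks and Lüscher's schedule the LO member is equivariant under every EVEN translation, and the FT-HMC kernel commutes with it

HONEST FRAMING: exact (Metropolis-corrected) sampling algorithms for lattice gauge theory;
figures of merit are autocorrelation/cost numbers at stated couplings and volumes; no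
continuum-physics claim.

Venture `LatticeQCDFlow` (cell pub-lqcd), topic `Exactness`; FANOUT row 14 (`eng-flowhmc`; the
row's acceptance test: FT-HMC through the LO Wilson-flow member on the 4⁴ `SU(2)` lattice, parity
masks, Lüscher's sweep schedule `(μ, even), (μ, odd)` for `μ = 0, …, 3`, refusal rule `6|ε| < 1`).
NEW WORK of the cell; nothing is cited as a fact; no number.  ASSEMBLY of
`SU2WilsonFlowLOTranslation.su2WilsonFlowLO_member_translate` (the member is translation equivariant
under every mask-preserving translation) with GEN-10's
`SU2FTHMCTranslationCovariance.su2_fthmc_conjKernel_translate`: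

* `exists_additive_properMask` — the engine's phase masks `x ↦ (Σᵢ xᵢ) mod w` (`w ∣ L`, `w ≠ 1`)
  are proper colourings AND additive, `χ (x + y) = χ x + χ y`; so a translation `t` preserves the
  mask iff `χ t = 0` ("even" translations for the parity mask `w = 2`: half of all translations).
* **`su2_fthmc_acceptanceLattice_translationCovariant`** — on the 4⁴ `SU(2)` lattice there is an
  additive parity colouring `χ` and, for every `nsweeps`, a list of `8·nsweeps` certified layers
  whose maps / densities ARE the masked LO Wilson-flow sub-steps / booked Jacobians of Lüscher's
  schedule (formulas VERBATIM as in `exists_layers_su2WilsonFlowLO`), such that for EVERY EVEN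
  translation `t` (`χ t = 0`): (i) the member `F` is translation equivariant, `F(V·t) = (F V)·t`,
  with translation-invariant running log-det `J(V·t) = J(V)`; (ii) for every measurable
  translation-invariant action `S`, every drift constant `c`, every measurable translation-covariant
  force routine `g` and every trajectory length `n`, the engine's FT-HMC configuration kernel
  commutes with the translation: `conjKernel K Θ_t = K`.

NOT CLAIMED: odd translations (they exchange the two parity classes: the sweep `(μ, even), (μ, odd)`
is carried to `(μ, odd), (μ, even)`, a different member); the exact-gradient force and `S = β·S_W`
(next file); rotations / reflections; any number.
-/

noncomputable section

namespace Summit.Ventures.LatticeQCDFlow.Exactness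

open Real Set MeasureTheory InnerProductGeometry WithLp
open ProbabilityTheory ProbabilityTheory.Kernel
open Literature.MathematicalPhysics.QuantumFieldTheory
open scoped ENNReal Matrix

/-- **Additive proper phase masks.**  For `w ∣ L`, `w ≠ 1`, the phase `χ x = (Σᵢ xᵢ) mod w` is a
proper colouring of the torus graph `(ℤ/L)^d` and a group homomorphism: `χ (x + y) = χ x + χ y`
(so `χ (x + t) = χ x` for every `t` with `χ t = 0`). -/
theorem exists_additive_properMask {d L w : ℕ} (hw : w ≠ 1) (hwL : w ∣ L) :
    ∃ χ : Site d L → ZMod w, (∀ (x : Site d L) (i : Fin d), χ (x.shift i) ≠ χ x) ∧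
      ∀ x y : Site d L, χ (x + y) = χ x + χ y := by
  haveI : Nontrivial (ZMod w) := ZMod.nontrivial_iff.mpr hw
  refine ⟨fun x => ZMod.castHom hwL (ZMod w) (∑ j, x j), fun x i => ?_, fun x y => ?_⟩
  · have h : ZMod.castHom hwL (ZMod w) (∑ j, (x.shift i) j) = ZMod.castHom hwL (ZMod w) (∑ j, x j) + 1 := by
      simp only [Site.shift, Pi.add_apply, Finset.sum_add_distrib, Finset.sum_pi_single',
        Finset.mem_univ, if_true, map_add, map_one]
    show ZMod.castHom hwL (ZMod w) (∑ j, (x.shift i) j) ≠ ZMod.castHom hwL (ZMod w) (∑ j, x j)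
    rw [h]
    exact fun h' => one_ne_zero (add_eq_left.mp h')
  · show ZMod.castHom hwL (ZMod w) (∑ j, (x + y) j) = ZMod.castHom hwL (ZMod w) (∑ j, x j) + ZMod.castHom hwL (ZMod w) (∑ j, y j)
    simp only [Pi.add_apply, Finset.sum_add_distrib, map_add]

/-- **4⁴ `SU(2)`, parity masks, Lüscher schedule, `6|ε| < 1`: the LO member is equivariant under
every EVEN translation and the FT-HMC kernel commutes with it** (translation-invariant measurable
action, translation-covariant measurable force routine; see the module docstring). -/
theorem su2_fthmc_acceptanceLattice_translationCovariant {ε : ℝ} (hε : |ε| * 6 < 1) (nsweeps : ℕ) :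
    ∃ χ : Site 4 4 → ZMod 2, (∀ (x : Site 4 4) (i : Fin 4), χ (x.shift i) ≠ χ x) ∧
      (∀ x y : Site 4 4, χ (x + y) = χ x + χ y) ∧
    ∃ layers : List ((GaugeConfig 4 4 (Matrix.specialUnitaryGroup (Fin 2) ℂ) ≃ᵐ GaugeConfig 4 4 (Matrix.specialUnitaryGroup (Fin 2) ℂ)) × (GaugeConfig 4 4 (Matrix.specialUnitaryGroup (Fin 2) ℂ) → ℝ)),
      layers.map (fun Ly => ((Ly.1 : GaugeConfig 4 4 (Matrix.specialUnitaryGroup (Fin 2) ℂ) → GaugeConfig 4 4 (Matrix.specialUnitaryGroup (Fin 2) ℂ)), Ly.2)) =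
        ((List.replicate nsweeps ((List.finRange 4).flatMap fun μ : Fin 4 => [(μ, (0 : ZMod 2)), (μ, 1)])).flatten).map (fun s =>
        ((fun (V : GaugeConfig 4 4 (Matrix.specialUnitaryGroup (Fin 2) ℂ)) (e : Edge 4 4) =>
        if e.2 = s.1 ∧ χ e.1 = s.2 then
          gaussUnit (geodesicKick ε (∑ ν ∈ Finset.univ.erase e.2,
            (vecQuat (((V (Site.shift e.1 e.2, ν) * (V (Site.shift e.1 ν, e.2))⁻¹ * (V (e.1, ν))⁻¹)⁻¹ : (Matrix.specialUnitaryGroup (Fin 2) ℂ)) : Matrix (Fin 2) (Fin 2) ℂ) +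
              vecQuat ((((V (Site.shift (e.1 - Pi.single ν 1) e.2, ν))⁻¹ * (V (e.1 - Pi.single ν 1, e.2))⁻¹ *
                V (e.1 - Pi.single ν 1, ν))⁻¹ : (Matrix.specialUnitaryGroup (Fin 2) ℂ)) : Matrix (Fin 2) (Fin 2) ℂ)))
            (vecQuat ((V e : (Matrix.specialUnitaryGroup (Fin 2) ℂ)) : Matrix (Fin 2) (Fin 2) ℂ)))
        else V e),
         fun V : GaugeConfig 4 4 (Matrix.specialUnitaryGroup (Fin 2) ℂ) => ∏ a : {e : Edge 4 4 // e.2 = s.1 ∧ χ e.1 = s.2},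
          (if Real.sin (angle (∑ ν ∈ Finset.univ.erase a.1.2,
            (vecQuat (((V (Site.shift a.1.1 a.1.2, ν) * (V (Site.shift a.1.1 ν, a.1.2))⁻¹ * (V (a.1.1, ν))⁻¹)⁻¹ : (Matrix.specialUnitaryGroup (Fin 2) ℂ)) : Matrix (Fin 2) (Fin 2) ℂ) +
              vecQuat ((((V (Site.shift (a.1.1 - Pi.single ν 1) a.1.2, ν))⁻¹ * (V (a.1.1 - Pi.single ν 1, a.1.2))⁻¹ *
                V (a.1.1 - Pi.single ν 1, ν))⁻¹ : (Matrix.specialUnitaryGroup (Fin 2) ℂ)) : Matrix (Fin 2) (Fin 2) ℂ))) (vecQuat ((V a.1 : (Matrix.specialUnitaryGroup (Fin 2) ℂ)) : Matrix (Fin 2) (Fin 2) ℂ))) = 0 then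
            (1 - ε * ‖(∑ ν ∈ Finset.univ.erase a.1.2,
            (vecQuat (((V (Site.shift a.1.1 a.1.2, ν) * (V (Site.shift a.1.1 ν, a.1.2))⁻¹ * (V (a.1.1, ν))⁻¹)⁻¹ : (Matrix.specialUnitaryGroup (Fin 2) ℂ)) : Matrix (Fin 2) (Fin 2) ℂ) +
              vecQuat ((((V (Site.shift (a.1.1 - Pi.single ν 1) a.1.2, ν))⁻¹ * (V (a.1.1 - Pi.single ν 1, a.1.2))⁻¹ *
                V (a.1.1 - Pi.single ν 1, ν))⁻¹ : (Matrix.specialUnitaryGroup (Fin 2) ℂ)) : Matrix (Fin 2) (Fin 2) ℂ)))‖ * Real.cos (angle (∑ ν ∈ Finset.univ.erase a.1.2,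
            (vecQuat (((V (Site.shift a.1.1 a.1.2, ν) * (V (Site.shift a.1.1 ν, a.1.2))⁻¹ * (V (a.1.1, ν))⁻¹)⁻¹ : (Matrix.specialUnitaryGroup (Fin 2) ℂ)) : Matrix (Fin 2) (Fin 2) ℂ) +
              vecQuat ((((V (Site.shift (a.1.1 - Pi.single ν 1) a.1.2, ν))⁻¹ * (V (a.1.1 - Pi.single ν 1, a.1.2))⁻¹ *
                V (a.1.1 - Pi.single ν 1, ν))⁻¹ : (Matrix.specialUnitaryGroup (Fin 2) ℂ)) : Matrix (Fin 2) (Fin 2) ℂ))) (vecQuat ((V a.1 : (Matrix.specialUnitaryGroup (Fin 2) ℂ)) : Matrix (Fin 2) (Fin 2) ℂ)))) ^ 3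
          else kickJac (ε * ‖(∑ ν ∈ Finset.univ.erase a.1.2,
            (vecQuat (((V (Site.shift a.1.1 a.1.2, ν) * (V (Site.shift a.1.1 ν, a.1.2))⁻¹ * (V (a.1.1, ν))⁻¹)⁻¹ : (Matrix.specialUnitaryGroup (Fin 2) ℂ)) : Matrix (Fin 2) (Fin 2) ℂ) +
              vecQuat ((((V (Site.shift (a.1.1 - Pi.single ν 1) a.1.2, ν))⁻¹ * (V (a.1.1 - Pi.single ν 1, a.1.2))⁻¹ *
                V (a.1.1 - Pi.single ν 1, ν))⁻¹ : (Matrix.specialUnitaryGroup (Fin 2) ℂ)) : Matrix (Fin 2) (Fin 2) ℂ)))‖) 2 (angle (∑ ν ∈ Finset.univ.erase a.1.2,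
            (vecQuat (((V (Site.shift a.1.1 a.1.2, ν) * (V (Site.shift a.1.1 ν, a.1.2))⁻¹ * (V (a.1.1, ν))⁻¹)⁻¹ : (Matrix.specialUnitaryGroup (Fin 2) ℂ)) : Matrix (Fin 2) (Fin 2) ℂ) +
              vecQuat ((((V (Site.shift (a.1.1 - Pi.single ν 1) a.1.2, ν))⁻¹ * (V (a.1.1 - Pi.single ν 1, a.1.2))⁻¹ *
                V (a.1.1 - Pi.single ν 1, ν))⁻¹ : (Matrix.specialUnitaryGroup (Fin 2) ℂ)) : Matrix (Fin 2) (Fin 2) ℂ))) (vecQuat ((V a.1 : (Matrix.specialUnitaryGroup (Fin 2) ℂ)) : Matrix (Fin 2) (Fin 2) ℂ)))))) ∧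
      layers.length = 8 * nsweeps ∧
      (∀ t : Site 4 4, χ t = 0 →
        (∀ V : GaugeConfig 4 4 (Matrix.specialUnitaryGroup (Fin 2) ℂ), (layers.foldr (fun Ly (F : GaugeConfig 4 4 (Matrix.specialUnitaryGroup (Fin 2) ℂ) ≃ᵐ GaugeConfig 4 4 (Matrix.specialUnitaryGroup (Fin 2) ℂ)) => Ly.1.trans F)
        (MeasurableEquiv.refl (GaugeConfig 4 4 (Matrix.specialUnitaryGroup (Fin 2) ℂ)))) (fun e : Edge 4 4 => V (e.1 + t, e.2)) =
            fun e : Edge 4 4 => ((layers.foldr (fun Ly (F : GaugeConfig 4 4 (Matrix.specialUnitaryGroup (Fin 2) ℂ) ≃ᵐ GaugeConfig 4 4 (Matrix.specialUnitaryGroup (Fin 2) ℂ)) => Ly.1.trans F)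
        (MeasurableEquiv.refl (GaugeConfig 4 4 (Matrix.specialUnitaryGroup (Fin 2) ℂ)))) V) (e.1 + t, e.2)) ∧
        (∀ V : GaugeConfig 4 4 (Matrix.specialUnitaryGroup (Fin 2) ℂ), (layers.foldr (fun Ly K => fun v => Ly.2 v * K (Ly.1 v)) (fun _ => (1 : ℝ))) (fun e : Edge 4 4 => V (e.1 + t, e.2)) =
            (layers.foldr (fun Ly K => fun v => Ly.2 v * K (Ly.1 v)) (fun _ => (1 : ℝ))) V)) ∧
      ∀ (t : Site 4 4) (_ht : χ t = 0) {S : GaugeConfig 4 4 (Matrix.specialUnitaryGroup (Fin 2) ℂ) → ℝ} (hS : Measurable S)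
        (_hSi : ∀ V : GaugeConfig 4 4 (Matrix.specialUnitaryGroup (Fin 2) ℂ), S (fun e : Edge 4 4 => V (e.1 + t, e.2)) = S V) (c : ℝ)
        {g : GaugeConfig 4 4 (Matrix.specialUnitaryGroup (Fin 2) ℂ) → ((Edge 4 4 × Fin 3) → ℝ)} (hg : Measurable g)
        (_hgc : ∀ V : GaugeConfig 4 4 (Matrix.specialUnitaryGroup (Fin 2) ℂ), g (fun e : Edge 4 4 => V (e.1 + t, e.2)) = (fun q : Edge 4 4 × Fin 3 => (g V) ((q.1.1 + t, q.1.2), q.2))) (n : ℕ),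
    conjKernel
      (conjKernel
        (refreshUpdate
          (involMH
            (⇑((flip : Equiv.Perm (GaugeConfig 4 4 (Matrix.specialUnitaryGroup (Fin 2) ℂ) × ((Edge 4 4 × Fin 3) → ℝ))) *
                leapfrog (mulDrift fun p : ((Edge 4 4 × Fin 3) → ℝ) =>
                  fun ℓ : Edge 4 4 => gaussUnit (toLp 2
          ![Real.cos (c * Real.sqrt (p (ℓ, 0) ^ 2 + p (ℓ, 1) ^ 2 + p (ℓ, 2) ^ 2)),
            c * Real.sinc (c * Real.sqrt (p (ℓ, 0) ^ 2 + p (ℓ, 1) ^ 2 + p (ℓ, 2) ^ 2)) * p (ℓ, 0),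
            c * Real.sinc (c * Real.sqrt (p (ℓ, 0) ^ 2 + p (ℓ, 1) ^ 2 + p (ℓ, 2) ^ 2)) * p (ℓ, 1),
            c * Real.sinc (c * Real.sqrt (p (ℓ, 0) ^ 2 + p (ℓ, 1) ^ 2 + p (ℓ, 2) ^ 2)) * p (ℓ, 2)])) g ^ n))
            (measurable_flip_leapfrog_pow (measurable_mulDrift (measurable_su2Drift c)) hg n)
            fun z : GaugeConfig 4 4 (Matrix.specialUnitaryGroup (Fin 2) ℂ) × ((Edge 4 4 × Fin 3) → ℝ) =>
              (S ((layers.foldr (fun Ly (F : GaugeConfig 4 4 (Matrix.specialUnitaryGroup (Fin 2) ℂ) ≃ᵐ GaugeConfig 4 4 (Matrix.specialUnitaryGroup (Fin 2) ℂ)) => Ly.1.trans F)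
        (MeasurableEquiv.refl (GaugeConfig 4 4 (Matrix.specialUnitaryGroup (Fin 2) ℂ)))) z.1) - Real.log ((layers.foldr (fun Ly K => fun v => Ly.2 v * K (Ly.1 v)) (fun _ => (1 : ℝ))) z.1)) + ∑ i, z.2 i ^ 2 / 2)
          ((((volume : Measure ((Edge 4 4 × Fin 3) → ℝ)).withDensity
                  fun p => ENNReal.ofReal (Real.exp (-(∑ i, p i ^ 2 / 2)))) Set.univ)⁻¹ •
              (volume : Measure ((Edge 4 4 × Fin 3) → ℝ)).withDensity
                fun p => ENNReal.ofReal (Real.exp (-(∑ i, p i ^ 2 / 2)))))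
        (layers.foldr (fun Ly (F : GaugeConfig 4 4 (Matrix.specialUnitaryGroup (Fin 2) ℂ) ≃ᵐ GaugeConfig 4 4 (Matrix.specialUnitaryGroup (Fin 2) ℂ)) => Ly.1.trans F)
        (MeasurableEquiv.refl (GaugeConfig 4 4 (Matrix.specialUnitaryGroup (Fin 2) ℂ)))))
      ({ toFun := fun V : GaugeConfig 4 4 (Matrix.specialUnitaryGroup (Fin 2) ℂ) => (fun e : Edge 4 4 => V (e.1 + t, e.2)),
         invFun := fun V : GaugeConfig 4 4 (Matrix.specialUnitaryGroup (Fin 2) ℂ) => (fun e : Edge 4 4 => V (e.1 - t, e.2)),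
         left_inv := fun V => funext fun e => by simp only [sub_add_cancel],
         right_inv := fun V => funext fun e => by simp only [add_sub_cancel_right],
         measurable_toFun := measurable_pi_lambda _ fun e => measurable_pi_apply _,
         measurable_invFun := measurable_pi_lambda _ fun e => measurable_pi_apply _ } : GaugeConfig 4 4 (Matrix.specialUnitaryGroup (Fin 2) ℂ) ≃ᵐ GaugeConfig 4 4 (Matrix.specialUnitaryGroup (Fin 2) ℂ)) =
      (conjKernel
        (refreshUpdate
          (involMH
            (⇑((flip : Equiv.Perm (GaugeConfig 4 4 (Matrix.specialUnitaryGroup (Fin 2) ℂ) × ((Edge 4 4 × Fin 3) → ℝ))) *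
                leapfrog (mulDrift fun p : ((Edge 4 4 × Fin 3) → ℝ) =>
                  fun ℓ : Edge 4 4 => gaussUnit (toLp 2
          ![Real.cos (c * Real.sqrt (p (ℓ, 0) ^ 2 + p (ℓ, 1) ^ 2 + p (ℓ, 2) ^ 2)),
            c * Real.sinc (c * Real.sqrt (p (ℓ, 0) ^ 2 + p (ℓ, 1) ^ 2 + p (ℓ, 2) ^ 2)) * p (ℓ, 0),
            c * Real.sinc (c * Real.sqrt (p (ℓ, 0) ^ 2 + p (ℓ, 1) ^ 2 + p (ℓ, 2) ^ 2)) * p (ℓ, 1),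
            c * Real.sinc (c * Real.sqrt (p (ℓ, 0) ^ 2 + p (ℓ, 1) ^ 2 + p (ℓ, 2) ^ 2)) * p (ℓ, 2)])) g ^ n))
            (measurable_flip_leapfrog_pow (measurable_mulDrift (measurable_su2Drift c)) hg n)
            fun z : GaugeConfig 4 4 (Matrix.specialUnitaryGroup (Fin 2) ℂ) × ((Edge 4 4 × Fin 3) → ℝ) =>
              (S ((layers.foldr (fun Ly (F : GaugeConfig 4 4 (Matrix.specialUnitaryGroup (Fin 2) ℂ) ≃ᵐ GaugeConfig 4 4 (Matrix.specialUnitaryGroup (Fin 2) ℂ)) => Ly.1.trans F)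
        (MeasurableEquiv.refl (GaugeConfig 4 4 (Matrix.specialUnitaryGroup (Fin 2) ℂ)))) z.1) - Real.log ((layers.foldr (fun Ly K => fun v => Ly.2 v * K (Ly.1 v)) (fun _ => (1 : ℝ))) z.1)) + ∑ i, z.2 i ^ 2 / 2)
          ((((volume : Measure ((Edge 4 4 × Fin 3) → ℝ)).withDensity
                  fun p => ENNReal.ofReal (Real.exp (-(∑ i, p i ^ 2 / 2)))) Set.univ)⁻¹ •
              (volume : Measure ((Edge 4 4 × Fin 3) → ℝ)).withDensity
                fun p => ENNReal.ofReal (Real.exp (-(∑ i, p i ^ 2 / 2)))))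
        (layers.foldr (fun Ly (F : GaugeConfig 4 4 (Matrix.specialUnitaryGroup (Fin 2) ℂ) ≃ᵐ GaugeConfig 4 4 (Matrix.specialUnitaryGroup (Fin 2) ℂ)) => Ly.1.trans F)
        (MeasurableEquiv.refl (GaugeConfig 4 4 (Matrix.specialUnitaryGroup (Fin 2) ℂ))))) := by
  obtain ⟨χ, hχ, hadd⟩ := exists_additive_properMask (d := 4) (L := 4) (w := 2) (by decide) (by decide)
  have hε' : |ε| * (2 * ((4 - 1 : ℕ) : ℝ)) < 1 := by norm_num; linarith
  obtain ⟨layers, hmap, -, hmeas, -⟩ := exists_layers_su2WilsonFlowLO χ hχ hε'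
    ((List.replicate nsweeps ((List.finRange 4).flatMap fun μ : Fin 4 => [(μ, (0 : ZMod 2)), (μ, 1)])).flatten)
  have heven : ∀ t : Site 4 4, χ t = 0 → ∀ x : Site 4 4, χ (x + t) = χ x := fun t ht x => by
    rw [hadd, ht, add_zero]
  refine ⟨χ, hχ, hadd, layers, hmap, ?_, ?_, ?_⟩
  · have hl := congrArg List.length hmap
    rw [List.length_map, List.length_map, length_luscherSchedule_four] at hl
    exact hl
  · intro t ht
    exact su2WilsonFlowLO_member_translate χ t (heven t ht) ε _ layers hmap
  · intro t ht S hS hSi c g hg hgc n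
    have hm := su2WilsonFlowLO_member_translate χ t (heven t ht) ε _ layers hmap
    exact su2_fthmc_conjKernel_translate t _ hm.1 (measurable_foldr_logDet layers hmeas) hm.2 hS hSi c hg hgc n

end Summit.Ventures.LatticeQCDFlow.Exactness
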